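import Literature.Computability.Complexity.AffineHashing
import Literature.Computability.AlgebraicComplexity.LaserHashing
import Literature.Computability.Complexity.ApproximateCounting
import HarnessLib

/-!
# Stockmeyer's estimator: approximate counting from pairwise-independent hashing (trunk CplxCore)

The probabilistic content of **Stockmeyer's approximate counting theorem** in the form of
Aaronson–Arkhipov, *The computational complexity of linear optics*, Theory of Computing 9 (2013),
Thm. 4.1 (p. 175; the tree's named fact `stockmeyerApproxCounting`, `ApproximateCounting.lean`):
the number `# = #{y ∈ {0,1}^m | ⟨x, y⟩ ∈ R}` of witnesses (`countWitnesses R m x`) is estimated to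
within a factor `1 + 1/kη`, with failure probability `≤ 1/kδ` over the coins, from the answers to
polynomially many *threshold questions* "are there at least `c` witnesses `y` with `h_k(y) = 0`?"
(`c ≤ T`, levels `k ≤ m`), each of which is an `NP^R` question. Everything here is proved
(Mathlib + `AffineHashing.lean`); no machine is built — the oracle transducer asking the questions
and the `NP^O` language answering them are the remaining, programming, half of a discharge of
`stockmeyerApproxCounting`, and this file fixes the interface for it: the coin layout (`coinHash`,
`rowParity`), the counts asked about (`levelCount`), the estimator (`estimate`, which only depends
on the counts capped at `T`, `estimate_congr`) and the final bound
(`uniformProb_not_isApproxCount_le`).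

The estimator is the Chebyshev variant of the Sipser–Stockmeyer hashing technique (the tool of the
Goldwasser–Sipser set lower bound protocol, Arora–Barak 2009, §8.2.2, pp. 184–188): with the affine
family `h(y) = Ay + b` over `𝔽₂` (AB Def. 8.14, Exercise 8.4; pairwise independent,
`AffineHash.card_filter_hash_pair`) the number `Y_k = #{y ∈ S | h_k(y) = 0}` of elements of a set
`S ⊆ {0,1}^m` hashed to zero by a random `h_k : {0,1}^m → {0,1}^k` has mean `|S|/2^k` and variance
`≤ |S|/2^k` (AB Claim A.13), so by Chebyshev (AB Lemma A.12) `2^k Y_k` is within a `1/(2kη)` fraction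
of `|S|` except with probability `4kη² 2^k/|S|`; summed over the *heavy* levels (`|S| ≥ C 2^k`,
`C = 8 kη² kδ`) this is `≤ 1/kδ`, and on that good event the first level `k` with `Y_k < T`
(`T ≥ 3C`; it exists, and is heavy) gives `N = 2^k Y_k` with `#/(1 + 1/kη) ≤ N ≤ (1 + 1/kη) #`.

* `AffineHash.zeroCount`, `sum_zeroCount_mul` (mean), `sum_zeroCount_sq_mul` (second moment),
  `sum_dev_sq` (variance identity `Σ_h (2^k Y_h − |S|)² = |S| |H| (2^k − 1)`), `badHash`,
  **`card_badHash_mul_le`** (Chebyshev, counting form);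
* `Stockmeyer.findLevel`, `Stockmeyer.estimate`, `estimate_congr`, **`isApproxCount_estimate`**
  (the deterministic core: good heavy levels ⇒ accurate estimate);
* coins as hash families: `coinBit`, `rowStart`, `coinHash` (level `k` = rows `0..k-1`, row `j` at
  coins `j(m+1) … j(m+1)+m`), the bit-level evaluation `rowParity` / `HashesToZero` a machine
  performs and its agreement with the `𝔽₂` hash (`hash_coinHash_apply`, `hash_coinHash_eq_zero_iff`),
  equal fibres of the coordinate projection (`proj`, `proj_surjective`, `card_filter_coinHash`);
* the union bound `card_badCoins_mul_le`, and for a relation `R`: `witnessSet`, `levelCount`,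
  `levelCount_zero`, **`card_not_isApproxCount_mul_le`**, **`uniformProb_not_isApproxCount_le`**:
  for `kη, kδ ≥ 1`, `T ≥ 24 kη² kδ`, `ℓ ≥ m(m+1)`,
  `Pr_{u ∈ {0,1}^ℓ}[¬ IsApproxCount kη # (estimate m T (levelCount R m x u))] ≤ 1/kδ`.

## References

* S. Aaronson, A. Arkhipov, *The computational complexity of linear optics*, Theory of Computing 9
  (2013) 143–252, Thm. 4.1 (p. 175), after L. J. Stockmeyer, *On approximation algorithms for #P*,
  SIAM J. Comput. 14 (1985) 849–861, and M. Sipser, *A complexity theoretic approach to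
  randomness*, STOC 1983.
* S. Arora, B. Barak, *Computational Complexity: A Modern Approach*, CUP 2009, §8.2.2 (set lower
  bound; Def. 8.14, Thm. 8.15, Exercise 8.4: pairwise independent (affine) hashing), Lemma A.12
  (Chebyshev), Claim A.13 (variance of a pairwise independent sum).
-/

namespace Literature.Computability.Complexity

open Finset

open scoped Classical

namespace AffineHash

variable {m k : ℕ}

/-! ### The number of elements of a set hashed to zero: mean and second moment -/

/-- `zeroCount S h = #{x ∈ S | h(x) = 0}`, the number of elements of `S` that the affine hash `h`
sends to `0 ∈ 𝔽₂^k` (the random variable of Stockmeyer's estimator). [folklore] -/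
def zeroCount (S : Finset (Fin m → ZMod 2)) (h : Hash m k) : ℕ :=
  (S.filter fun x => hash h x = 0).card

/-- `zeroCount` as a sum of indicators. [folklore] -/
theorem zeroCount_eq_sum (S : Finset (Fin m → ZMod 2)) (h : Hash m k) :
    zeroCount S h = ∑ x ∈ S, if hash h x = 0 then 1 else 0 := by
  rw [zeroCount, card_filter]

/-- `zeroCount S h ≤ |S|`. [folklore] -/
theorem zeroCount_le (S : Finset (Fin m → ZMod 2)) (h : Hash m k) : zeroCount S h ≤ S.card :=
  card_filter_le _ _

/-- Into `𝔽₂^0` everything hashes to zero: `zeroCount S h = |S|` for `k = 0`. [folklore] -/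
theorem zeroCount_zero (S : Finset (Fin m → ZMod 2)) (h : Hash m 0) : zeroCount S h = S.card := by
  rw [zeroCount, filter_true_of_mem]
  intro x _
  exact Subsingleton.elim _ _

/-- **Mean**: `2^k · Σ_h zeroCount S h = |S| · |H|` (each `x` is hashed to `0` by a `2^{-k}`
fraction of the family, `card_filter_hash_eq`). [cite: AroraBarakCC2009, Thm. 8.15 (p. 185)] -/
theorem sum_zeroCount_mul (S : Finset (Fin m → ZMod 2)) :
    (∑ h : Hash m k, zeroCount S h) * 2 ^ k = S.card * Fintype.card (Hash m k) := by
  have hswap : ∑ h : Hash m k, zeroCount S h =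
      ∑ x ∈ S, (univ.filter fun h : Hash m k => hash h x = 0).card := by
    simp only [zeroCount_eq_sum, card_filter]
    exact sum_comm
  rw [hswap, sum_mul, sum_congr rfl fun x _ => card_filter_hash_eq (k := k) x 0, sum_const,
    smul_eq_mul]

/-- **Second moment**: `4^k · Σ_h (zeroCount S h)² + |S|·|H| = 2^k·|S|·|H| + |S|²·|H|` — the
diagonal terms by one-point uniformity, the off-diagonal ones by pairwise independence
(`card_filter_hash_pair`). [cite: AroraBarakCC2009, Thm. 8.15 (p. 185) with Claim A.13 (p. 604)] -/
theorem sum_zeroCount_sq_mul (S : Finset (Fin m → ZMod 2)) :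
    (∑ h : Hash m k, zeroCount S h ^ 2) * (2 ^ k * 2 ^ k) + S.card * Fintype.card (Hash m k) =
      2 ^ k * S.card * Fintype.card (Hash m k) + S.card * S.card * Fintype.card (Hash m k) := by
  -- the indicator events
  set E : (Fin m → ZMod 2) → Finset (Hash m k) := fun x => univ.filter fun h => hash h x = 0
    with hE
  have h1 : ∀ x, (E x).card * 2 ^ k = Fintype.card (Hash m k) := fun x =>
    card_filter_hash_eq (k := k) x 0
  have h2 : ∀ x ∈ S, ∀ x' ∈ S.erase x, (E x ∩ E x').card * (2 ^ k * 2 ^ k) =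
      Fintype.card (Hash m k) := by
    intro x _ x' hx'
    have hne : x ≠ x' := (ne_of_mem_erase hx').symm
    have := card_filter_hash_pair hne (0 : Fin k → ZMod 2) 0
    rw [← this]
    congr 2
    ext h; simp [hE, filter_inter, mem_filter, and_comm]
  -- expand the square as a double sum of joint indicators and swap the sums
  have hsq : ∀ h : Hash m k, zeroCount S h ^ 2 =
      ∑ x ∈ S, ∑ x' ∈ S, if hash h x = 0 ∧ hash h x' = 0 then 1 else 0 := by
    intro h
    rw [zeroCount_eq_sum, sq, sum_mul_sum]
    refine sum_congr rfl fun x _ => sum_congr rfl fun x' _ => ?_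
    split_ifs <;> simp_all
  have hswap : ∑ h : Hash m k, zeroCount S h ^ 2 = ∑ x ∈ S, ∑ x' ∈ S, (E x ∩ E x').card := by
    simp only [hsq]
    rw [sum_comm]
    refine sum_congr rfl fun x _ => ?_
    rw [sum_comm]
    refine sum_congr rfl fun x' _ => ?_
    rw [card_eq_sum_ones, hE, ← filter_and, sum_filter]
  -- split off the diagonal
  have hdiag : ∀ x ∈ S, ∑ x' ∈ S, (E x ∩ E x').card =
      (E x).card + ∑ x' ∈ S.erase x, (E x ∩ E x').card := by
    intro x hx
    rw [← add_sum_erase S _ hx, inter_self]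
  rw [hswap, sum_congr rfl hdiag, sum_mul, add_comm]
  have hterm : ∀ x ∈ S, ((E x).card + ∑ x' ∈ S.erase x, (E x ∩ E x').card) * (2 ^ k * 2 ^ k) =
      2 ^ k * Fintype.card (Hash m k) + (S.card - 1) * Fintype.card (Hash m k) := by
    intro x hx
    rw [add_mul, sum_mul, sum_congr rfl fun x' hx' => h2 x hx x' hx', sum_const, smul_eq_mul,
      card_erase_of_mem hx, ← h1 x]
    ring
  rw [sum_congr rfl hterm, sum_const, smul_eq_mul]
  rcases Nat.eq_zero_or_pos S.card with h0 | hpos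
  · simp [h0]
  · obtain ⟨s, hs⟩ : ∃ s, S.card = s + 1 := ⟨S.card - 1, by omega⟩
    rw [hs]
    simp only [Nat.add_sub_cancel]
    ring

/-- The deviation of the scaled count from its mean: `D_h = 2^k · zeroCount S h − |S|`.
[folklore] -/
def dev (S : Finset (Fin m → ZMod 2)) (h : Hash m k) : ℤ :=
  (2 ^ k * zeroCount S h : ℕ) - (S.card : ℤ)

/-- **Variance identity**: `Σ_h D_h² + |S|·|H| = 2^k·|S|·|H|`, i.e.
`Var[2^k · zeroCount] = |S| (2^k − 1)` for a uniformly random affine hash. [cite: AroraBarakCC2009, Claim A.13 (p. 604) with Thm. 8.15 (p. 185)] -/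
theorem sum_dev_sq (S : Finset (Fin m → ZMod 2)) :
    ∑ h : Hash m k, dev S h ^ 2 + (S.card * Fintype.card (Hash m k) : ℕ) =
      (2 ^ k * S.card * Fintype.card (Hash m k) : ℕ) := by
  have hmean := sum_zeroCount_mul (k := k) S
  have hsq := sum_zeroCount_sq_mul (k := k) S
  -- pass to `ℤ`
  have hmeanZ : (∑ h : Hash m k, (zeroCount S h : ℤ)) * 2 ^ k = S.card * Fintype.card (Hash m k) := by
    exact_mod_cast hmean
  have hsqZ : (∑ h : Hash m k, (zeroCount S h : ℤ) ^ 2) * (2 ^ k * 2 ^ k) +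
      S.card * Fintype.card (Hash m k) =
      2 ^ k * S.card * Fintype.card (Hash m k) + S.card * S.card * Fintype.card (Hash m k) := by
    exact_mod_cast hsq
  have hexp : ∀ h : Hash m k, dev S h ^ 2 =
      (zeroCount S h : ℤ) ^ 2 * (2 ^ k * 2 ^ k) - 2 * S.card * ((zeroCount S h : ℤ) * 2 ^ k) +
        (S.card : ℤ) ^ 2 := by
    intro h; simp only [dev, Nat.cast_mul, Nat.cast_pow, Nat.cast_ofNat]; ring
  simp only [hexp, sum_add_distrib, sum_sub_distrib, ← sum_mul, ← mul_sum, sum_const, card_univ]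
  push_cast
  rw [hmeanZ]
  linear_combination hsqZ

/-- `Σ_h D_h² ≤ 2^k · |S| · |H|`. [folklore] -/
theorem sum_dev_sq_le (S : Finset (Fin m → ZMod 2)) :
    ∑ h : Hash m k, dev S h ^ 2 ≤ (2 ^ k * S.card * Fintype.card (Hash m k) : ℕ) := by
  have := sum_dev_sq (k := k) S
  have h0 : (0 : ℤ) ≤ (S.card * Fintype.card (Hash m k) : ℕ) := by positivity
  linarith

/-! ### Chebyshev: few hashes deviate by a `1/E` fraction -/

/-- The hashes whose scaled zero-count deviates from `|S|` by at least `|S|/E`: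
`badHash E S = {h | |S| ≤ E · |2^k · zeroCount S h − |S||}`. [folklore] -/
def badHash (E : ℕ) (S : Finset (Fin m → ZMod 2)) : Finset (Hash m k) :=
  univ.filter fun h => (S.card : ℤ) ≤ E * |dev S h|

/-- **Chebyshev's inequality for the zero-count** (counting form):
`#badHash · |S| ≤ E² · 2^k · |H|`, i.e. `Pr_h[|2^k Y_h − |S|| ≥ |S|/E] ≤ E² 2^k/|S|`. [cite: AroraBarakCC2009, Lemma A.12 (p. 604) with Claim A.13] -/
theorem card_badHash_mul_le (E : ℕ) (S : Finset (Fin m → ZMod 2)) :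
    (badHash (k := k) E S).card * S.card ≤ E ^ 2 * 2 ^ k * Fintype.card (Hash m k) := by
  rcases Nat.eq_zero_or_pos S.card with h0 | hpos
  · simp [h0]
  -- `#bad · s² ≤ Σ_{h bad} (E D_h)² ≤ E² Σ_h D_h² ≤ E² s 2^k |H|`
  have hstep : ((badHash (k := k) E S).card : ℤ) * ((S.card : ℤ) ^ 2) ≤
      (E : ℤ) ^ 2 * ∑ h : Hash m k, dev S h ^ 2 := by
    calc ((badHash (k := k) E S).card : ℤ) * ((S.card : ℤ) ^ 2)
        = ∑ h ∈ badHash (k := k) E S, (S.card : ℤ) ^ 2 := by rw [sum_const, nsmul_eq_mul]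
      _ ≤ ∑ h ∈ badHash (k := k) E S, (E : ℤ) ^ 2 * dev S h ^ 2 := by
          refine sum_le_sum fun h hh => ?_
          have hb : (S.card : ℤ) ≤ E * |dev S h| := (mem_filter.1 hh).2
          have h0' : (0 : ℤ) ≤ S.card := by positivity
          calc (S.card : ℤ) ^ 2 ≤ (E * |dev S h|) ^ 2 := pow_le_pow_left₀ h0' hb 2
            _ = (E : ℤ) ^ 2 * dev S h ^ 2 := by rw [mul_pow, sq_abs]
      _ ≤ ∑ h : Hash m k, (E : ℤ) ^ 2 * dev S h ^ 2 :=
          sum_le_sum_of_subset_of_nonneg (subset_univ _) fun h _ _ => by positivity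
      _ = (E : ℤ) ^ 2 * ∑ h : Hash m k, dev S h ^ 2 := by rw [mul_sum]
  have hvar := sum_dev_sq_le (k := k) S
  have hE0 : (0 : ℤ) ≤ (E : ℤ) ^ 2 := by positivity
  have hfin : ((badHash (k := k) E S).card : ℤ) * ((S.card : ℤ) ^ 2) ≤
      (E : ℤ) ^ 2 * (2 ^ k * S.card * Fintype.card (Hash m k) : ℕ) :=
    hstep.trans (mul_le_mul_of_nonneg_left hvar hE0)
  -- cancel one factor `s`
  have hs : (0 : ℤ) < S.card := by exact_mod_cast hpos
  have : ((badHash (k := k) E S).card : ℤ) * S.card ≤ (E : ℤ) ^ 2 * 2 ^ k * Fintype.card (Hash m k) := by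
    have h' : ((badHash (k := k) E S).card : ℤ) * S.card * S.card ≤
        ((E : ℤ) ^ 2 * 2 ^ k * Fintype.card (Hash m k)) * S.card := by
      have := hfin; push_cast at this; nlinarith [this]
    exact le_of_mul_le_mul_right h' hs
  exact_mod_cast this

end AffineHash

namespace Stockmeyer

open AffineHash

/-! ### The estimator: the first level whose zero-count is small -/

/-- `findLevel m T Y`: the first level `k ≤ m` whose count `Y k` is below the threshold `T`
(the level at which Stockmeyer's estimator reads off the set size). [cite: AaronsonArkhipovToC2013, Thm. 4.1 (p. 175)] -/
def findLevel (m T : ℕ) (Y : ℕ → ℕ) : Option ℕ :=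
  (List.range (m + 1)).find? fun k => decide (Y k < T)

/-- **Stockmeyer's estimator** from the level counts `Y k = #{x ∈ S | h_k(x) = 0}`: at the first
level `k ≤ m` with `Y k < T`, output `Y k · 2^k` (and `0` if there is none). [cite: AaronsonArkhipovToC2013, Thm. 4.1 (p. 175)] -/
def estimate (m T : ℕ) (Y : ℕ → ℕ) : ℕ :=
  match findLevel m T Y with
  | none => 0
  | some k => Y k * 2 ^ k

/-- What `findLevel` finds: a level `k ≤ m` with `Y k < T` below which all counts are `≥ T`.
[folklore] -/
theorem findLevel_eq_some_iff {m T : ℕ} {Y : ℕ → ℕ} {k : ℕ} :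
    findLevel m T Y = some k ↔ k ≤ m ∧ Y k < T ∧ ∀ j < k, T ≤ Y j := by
  rw [findLevel, List.find?_range_eq_some]
  simp only [decide_eq_true_eq, List.mem_range, Bool.not_eq_true', decide_eq_false_iff_not,
    not_lt]
  constructor
  · rintro ⟨h1, h2, h3⟩; exact ⟨by omega, h1, h3⟩
  · rintro ⟨h1, h2, h3⟩; exact ⟨h2, by omega, h3⟩

/-- `findLevel` fails iff all counts up to level `m` are `≥ T`. [folklore] -/
theorem findLevel_eq_none_iff {m T : ℕ} {Y : ℕ → ℕ} :
    findLevel m T Y = none ↔ ∀ k ≤ m, T ≤ Y k := by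
  rw [findLevel, List.find?_range_eq_none]
  simp only [Bool.not_eq_true', decide_eq_false_iff_not, not_lt]
  constructor
  · intro h k hk; exact h k (by omega)
  · intro h k hk; exact h k (by omega)

/-- If some level `k₁ ≤ m` has a small count then `findLevel` finds a level `≤ k₁`. [folklore] -/
theorem exists_findLevel_le {m T : ℕ} {Y : ℕ → ℕ} {k₁ : ℕ} (hk₁ : k₁ ≤ m) (hY : Y k₁ < T) :
    ∃ k, findLevel m T Y = some k ∧ k ≤ k₁ := by
  cases hf : findLevel m T Y with
  | none => exact absurd (findLevel_eq_none_iff.1 hf k₁ hk₁) (not_le.2 hY)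
  | some k =>
    refine ⟨k, rfl, ?_⟩
    by_contra hlt
    exact absurd ((findLevel_eq_some_iff.1 hf).2.2 k₁ (by omega)) (not_le.2 hY)

/-- The value of the estimator at a found level. [folklore] -/
theorem estimate_eq_of_findLevel {m T : ℕ} {Y : ℕ → ℕ} {k : ℕ} (h : findLevel m T Y = some k) :
    estimate m T Y = Y k * 2 ^ k := by
  simp only [estimate, h]

/-- The estimator only depends on the counts capped at `T` (what the `T` threshold queries
"`Y k ≥ c`?", `c = 1, …, T`, reveal). [folklore] -/
theorem estimate_congr {m T : ℕ} {Y Y' : ℕ → ℕ} (h : ∀ k ≤ m, min (Y k) T = min (Y' k) T) :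
    estimate m T Y = estimate m T Y' := by
  have hlt : ∀ k ≤ m, (Y k < T ↔ Y' k < T) := fun k hk => by
    have := h k hk
    constructor <;> intro h' <;> by_contra h'' <;> push Not at h'' <;> omega
  have hle : ∀ k ≤ m, (T ≤ Y k ↔ T ≤ Y' k) := fun k hk => by rw [← not_lt, hlt k hk, not_lt]
  cases h' : findLevel m T Y' with
  | none =>
    have hY : findLevel m T Y = none :=
      findLevel_eq_none_iff.2 fun k hk => (hle k hk).2 (findLevel_eq_none_iff.1 h' k hk)
    simp only [estimate, hY, h']
  | some k =>
    obtain ⟨hk, hYk, hbelow⟩ := findLevel_eq_some_iff.1 h'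
    have hY : findLevel m T Y = some k :=
      findLevel_eq_some_iff.2 ⟨hk, (hlt k hk).2 hYk, fun j hj => (hle j (by omega)).2 (hbelow j hj)⟩
    have hv : Y k = Y' k := by
      have := h k hk
      rwa [min_eq_left ((hlt k hk).2 hYk).le, min_eq_left hYk.le] at this
    simp only [estimate, hY, h', hv]

/-! ### On good hash families the estimate is accurate -/

/-- **Deterministic core of Stockmeyer's estimator.** Let `s ≤ 2^m` be the set size, `Y 0 = s`
(level `0` hashes everything to the empty vector), `C ≥ 1` and `T ≥ 3C`. If at every *heavy*
level `k ≤ m` (`C·2^k ≤ s`) the scaled count `2^k · Y k` is within `s/(2kη)` of `s`, then the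
estimate `N` satisfies `s/(1 + 1/kη) ≤ N ≤ (1 + 1/kη)·s`. (For `s < C` level `0` gives `N = s`;
otherwise the last heavy level `k₁ = ⌊log₂(s/C)⌋` has `Y k₁ < 3C ≤ T`, so a level `≤ k₁`, hence a
heavy one, is found.) [cite: AaronsonArkhipovToC2013, Thm. 4.1 (p. 175)] -/
theorem isApproxCount_estimate {kη C T m s : ℕ} {Y : ℕ → ℕ} (hkη : 0 < kη) (hC : 0 < C)
    (hT : 3 * C ≤ T) (hY0 : Y 0 = s) (hs : s ≤ 2 ^ m)
    (hgood : ∀ k ≤ m, C * 2 ^ k ≤ s → (2 * kη : ℤ) * |((2 ^ k * Y k : ℕ) : ℤ) - s| < s) :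
    IsApproxCount kη s (estimate m T Y) := by
  by_cases hsC : s < C
  · -- level 0 is found and exact
    obtain ⟨k, hk, hk0⟩ := exists_findLevel_le (m := m) (T := T) (Y := Y) (k₁ := 0) (Nat.zero_le _)
      (by rw [hY0]; omega)
    obtain rfl : k = 0 := by omega
    rw [estimate_eq_of_findLevel hk, hY0, pow_zero, mul_one]
    exact isApproxCount_self kη s
  push Not at hsC
  have hspos : 0 < s := lt_of_lt_of_le hC hsC
  -- the last heavy level
  set k₁ := Nat.log 2 (s / C) with hk₁
  have hq : 1 ≤ s / C := (Nat.le_div_iff_mul_le hC).2 (by simpa using hsC)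
  have hpow : 2 ^ k₁ ≤ s / C := Nat.pow_log_le_self 2 (by omega)
  have hheavy₁ : C * 2 ^ k₁ ≤ s := (Nat.mul_le_mul_left C hpow).trans (Nat.mul_div_le s C)
  have hlt₁ : s < C * 2 ^ (k₁ + 1) := by
    have h1 : s / C < 2 ^ (k₁ + 1) := Nat.lt_pow_succ_log_self (by norm_num) _
    have h2 : s < (s / C + 1) * C := by
      have := Nat.lt_div_mul_add (a := s) hC; linarith [Nat.div_mul_le_self s C, this]
    calc s < (s / C + 1) * C := h2
      _ ≤ 2 ^ (k₁ + 1) * C := Nat.mul_le_mul_right C h1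
      _ = C * 2 ^ (k₁ + 1) := mul_comm _ _
  have hk₁m : k₁ ≤ m := by
    have : 2 ^ k₁ ≤ 2 ^ m := hpow.trans ((Nat.div_le_self s C).trans hs)
    exact (Nat.pow_le_pow_iff_right (by norm_num)).1 this
  -- at `k₁` the count is below `T`
  have hY₁ : Y k₁ < T := by
    have hg := hgood k₁ hk₁m hheavy₁
    by_contra hge
    push Not at hge
    have hbig : 3 * s < 2 * (2 ^ k₁ * Y k₁) := by
      have : 3 * C * 2 ^ k₁ ≤ 2 ^ k₁ * Y k₁ := by
        calc 3 * C * 2 ^ k₁ ≤ T * 2 ^ k₁ := Nat.mul_le_mul_right _ hT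
          _ ≤ Y k₁ * 2 ^ k₁ := Nat.mul_le_mul_right _ hge
          _ = 2 ^ k₁ * Y k₁ := mul_comm _ _
      calc 3 * s < 3 * (C * 2 ^ (k₁ + 1)) := by linarith
        _ = 2 * (3 * C * 2 ^ k₁) := by ring
        _ ≤ 2 * (2 ^ k₁ * Y k₁) := by linarith
    have hbigZ : (3 * s : ℤ) < 2 * ((2 ^ k₁ * Y k₁ : ℕ) : ℤ) := by exact_mod_cast hbig
    have habs : ((2 ^ k₁ * Y k₁ : ℕ) : ℤ) - s ≤ |((2 ^ k₁ * Y k₁ : ℕ) : ℤ) - s| := le_abs_self _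
    have hkη1 : (1 : ℤ) ≤ kη := by exact_mod_cast hkη
    nlinarith
  -- so a heavy level is found
  obtain ⟨k, hk, hkk₁⟩ := exists_findLevel_le hk₁m hY₁
  have hkm : k ≤ m := hkk₁.trans hk₁m
  have hheavy : C * 2 ^ k ≤ s :=
    (Nat.mul_le_mul_left C (Nat.pow_le_pow_right (by norm_num) hkk₁)).trans hheavy₁
  have hg := hgood k hkm hheavy
  rw [estimate_eq_of_findLevel hk, mul_comm]
  -- real arithmetic
  set V : ℕ := 2 ^ k * Y k with hV
  have hgR : (2 * kη : ℝ) * |(V : ℝ) - s| < s := by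
    have : ((2 * kη : ℤ) : ℝ) * ((|(V : ℤ) - s| : ℤ) : ℝ) < ((s : ℤ) : ℝ) := by
      exact_mod_cast (Int.cast_lt (R := ℝ)).2 hg
    push_cast at this
    exact this
  have hkηR : (0 : ℝ) < kη := by exact_mod_cast hkη
  have hkη1 : (1 : ℝ) ≤ kη := by exact_mod_cast hkη
  have hsR : (0 : ℝ) ≤ s := by positivity
  have h1 : (2 * kη : ℝ) * ((V : ℝ) - s) < s := lt_of_le_of_lt (by
    exact mul_le_mul_of_nonneg_left (le_abs_self _) (by positivity)) hgR
  have h2 : (2 * kη : ℝ) * ((s : ℝ) - V) < s := lt_of_le_of_lt (by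
    rw [← abs_sub_comm]; exact mul_le_mul_of_nonneg_left (le_abs_self _) (by positivity)) hgR
  have hg1 : (0 : ℝ) < 1 + 1 / kη := by positivity
  refine ⟨?_, ?_⟩
  · rw [div_le_iff₀ hg1]
    have : (V : ℝ) * (1 + 1 / kη) = (V * (kη + 1)) / kη := by field_simp
    rw [this, le_div_iff₀ hkηR]
    nlinarith
  · have : (1 + 1 / (kη : ℝ)) * s = (s * (kη + 1)) / kη := by field_simp
    rw [this, le_div_iff₀ hkηR]
    nlinarith


/-! ### Coin strings as affine hash families -/

/-- Bit `n` of the coin string `u` (`false` beyond its end). [folklore] -/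
def coinBit (u : List Bool) (n : ℕ) : Bool := u.getD n false

/-- The coins of row `j` start at position `j (m + 1)`: `m` matrix bits, then the offset bit.
The level-`k` hash uses rows `0, …, k − 1` (levels share rows; only the per-level marginals
matter). [folklore] -/
def rowStart (m j : ℕ) : ℕ := j * (m + 1)

/-- `Bool ↪ 𝔽₂`. [folklore] -/
def bz (b : Bool) : ZMod 2 := if b then 1 else 0

/-- `bz true = 1`. [folklore] -/
@[simp] theorem bz_true : bz true = 1 := rfl

/-- `bz false = 0`. [folklore] -/
@[simp] theorem bz_false : bz false = 0 := rfl

/-- `bz (a ∧ b) = bz a · bz b`. [folklore] -/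
theorem bz_and (a b : Bool) : bz (a && b) = bz a * bz b := by cases a <;> cases b <;> decide

/-- `bz (a ⊕ b) = bz a + bz b`. [folklore] -/
theorem bz_xor (a b : Bool) : bz (xor a b) = bz a + bz b := by cases a <;> cases b <;> decide

/-- `bz b = 0 ↔ b = false`. [folklore] -/
theorem bz_eq_zero_iff (b : Bool) : bz b = 0 ↔ b = false := by cases b <;> decide

/-- `bz` is injective. [folklore] -/
theorem bz_injective : Function.Injective bz := by
  intro a b h; revert h; cases a <;> cases b <;> decide

/-- The parity bit of `n`, in `𝔽₂`, is `n mod 2`. [folklore] -/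
theorem bz_decide_odd (n : ℕ) : bz (decide (Odd n)) = (n : ZMod 2) := by
  by_cases h : Odd n
  · rw [decide_eq_true h, bz_true, eq_comm, ZMod.natCast_eq_one_iff_odd]; exact h
  · rw [decide_eq_false h, bz_false, eq_comm, ZMod.natCast_eq_zero_iff_even]
    exact Nat.not_odd_iff_even.1 h

/-- The level-`k` affine hash `{0,1}^m → {0,1}^k` read off the coin string: row `j < k` has
matrix entries `u[j(m+1) + i]`, `i < m`, and offset `u[j(m+1) + m]`. [cite: AroraBarakCC2009, Def. 8.14 (p. 185) with Exercise 8.4 (p. 204)] -/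
def coinHash (u : List Bool) (m k : ℕ) : Hash m k :=
  (Matrix.of fun (j : Fin k) (i : Fin m) => bz (coinBit u (rowStart m j + i)),
    fun j : Fin k => bz (coinBit u (rowStart m j + m)))

/-- **Bit-level evaluation of row `j`** (what a machine computes): the parity of the bitwise
`AND` of the row's matrix bits with `y`, `XOR` the offset bit. [folklore] -/
def rowParity (u : List Bool) (m : ℕ) (y : List Bool) (j : ℕ) : Bool :=
  xor (decide (Odd (((u.drop (rowStart m j)).zipWith (· && ·) y).count true)))
    (coinBit u (rowStart m j + m))

/-- `y` hashes to `0 ∈ {0,1}^k` at level `k`: all rows `j < k` have parity `0`. [folklore] -/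
def HashesToZero (u : List Bool) (m k : ℕ) (y : List Bool) : Prop :=
  ∀ j < k, rowParity u m y j = false

/-- A Boolean vector as a point of `𝔽₂^m`. [folklore] -/
def toZ {m : ℕ} (y : List.Vector Bool m) : Fin m → ZMod 2 := fun i => bz (y.get i)

/-- `toZ` is injective. [folklore] -/
theorem toZ_injective {m : ℕ} : Function.Injective (toZ (m := m)) := by
  intro y y' h
  apply List.Vector.ext
  intro i
  exact bz_injective (congrFun h i)

/-- Entries of a vector through `getD` of its list. [folklore] -/
theorem get_eq_getD {m : ℕ} (y : List.Vector Bool m) (i : Fin m) : y.get i = y.toList.getD i false := by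
  rcases y with ⟨l, hl⟩
  rw [List.getD_eq_getElem?_getD, List.Vector.get_eq_get_toList]
  simp only [List.Vector.toList_mk, List.get_eq_getElem, Fin.val_cast]
  rw [List.getElem?_eq_getElem (by simp [hl])]
  rfl

/-- The number of `true`s in a bitwise `AND` is the number of positions where both bits are set.
[folklore] -/
theorem count_zipWith_and (a y : List Bool) :
    (a.zipWith (· && ·) y).count true =
      Nat.count (fun i => a.getD i false && y.getD i false) y.length := by
  induction y generalizing a with
  | nil => simp
  | cons b y ih =>
    cases a with
    | nil => simp [Nat.count_eq_card_filter_range]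
    | cons c a =>
      rw [List.zipWith_cons_cons, List.count_cons, ih, List.length_cons, Nat.count_succ']
      simp

/-- **The coin hash evaluates by row parities**: `(h_k(y))_j = rowParity u m y j`. [folklore] -/
theorem hash_coinHash_apply {m k : ℕ} (u : List Bool) (y : List.Vector Bool m) (j : Fin k) :
    hash (coinHash u m k) (toZ y) j = bz (rowParity u m y.toList j) := by
  simp only [AffineHash.hash, coinHash, Pi.add_apply, Matrix.mulVec, dotProduct, Matrix.of_apply,
    toZ, rowParity, bz_xor, bz_decide_odd]
  congr 1
  rw [count_zipWith_and, Nat.count_eq_card_filter_range, List.Vector.toList_length]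
  have hf : ∀ i : Fin m, bz (coinBit u (rowStart m j + i)) * bz (y.get i) =
      (fun n : ℕ => bz (coinBit u (rowStart m j + n) && y.toList.getD n false)) i := by
    intro i; rw [get_eq_getD, ← bz_and]
  rw [Finset.sum_congr rfl fun i _ => hf i, Fin.sum_univ_eq_sum_range
    (fun n : ℕ => bz (coinBit u (rowStart m j + n) && y.toList.getD n false)) m]
  simp only [bz, Finset.sum_boole]
  congr 2
  ext i
  simp [coinBit, List.getD_eq_getElem?_getD, List.getElem?_drop]

/-- `h_k(y) = 0` iff `y` hashes to zero at level `k` bitwise. [folklore] -/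
theorem hash_coinHash_eq_zero_iff {m k : ℕ} (u : List Bool) (y : List.Vector Bool m) :
    hash (coinHash u m k) (toZ y) = 0 ↔ HashesToZero u m k y.toList := by
  simp only [funext_iff, hash_coinHash_apply, Pi.zero_apply, bz_eq_zero_iff, HashesToZero,
    Fin.forall_iff]

/-! ### Counting coin strings through the hash they define -/

/-- Row/column positions are within the first `k (m+1)` coins. [folklore] -/
theorem rowStart_add_lt {m k ℓ j i : ℕ} (hℓ : k * (m + 1) ≤ ℓ) (hj : j < k) (hi : i ≤ m) :
    rowStart m j + i < ℓ := by
  have : (j + 1) * (m + 1) ≤ k * (m + 1) := Nat.mul_le_mul_right _ hj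
  rw [rowStart]; nlinarith

/-- Reading the first `k` rows of a coin vector as a hash: an additive map
`𝔽₂^ℓ → Hash m k`. [folklore] -/
def proj (m k ℓ : ℕ) (hℓ : k * (m + 1) ≤ ℓ) : (Fin ℓ → ZMod 2) →+ Hash m k where
  toFun v :=
    (Matrix.of fun (j : Fin k) (i : Fin m) => v ⟨rowStart m j + i, rowStart_add_lt hℓ j.2 i.2.le⟩,
      fun j : Fin k => v ⟨rowStart m j + m, rowStart_add_lt hℓ j.2 le_rfl⟩)
  map_zero' := by ext <;> simp
  map_add' := by intros; ext <;> simp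

/-- The projection is onto: the coordinates read are distinct. [folklore] -/
theorem proj_surjective {m k ℓ : ℕ} (hℓ : k * (m + 1) ≤ ℓ) : Function.Surjective (proj m k ℓ hℓ) := by
  rintro ⟨A, b⟩
  refine ⟨fun n => if hj : n.1 / (m + 1) < k then
    (if hi : n.1 % (m + 1) < m then A ⟨_, hj⟩ ⟨_, hi⟩ else b ⟨_, hj⟩) else 0, ?_⟩
  have hdiv : ∀ (j : Fin k) (i : ℕ), i ≤ m → (rowStart m j + i) / (m + 1) = j := by
    intro j i hi
    rw [rowStart, mul_comm, Nat.mul_add_div (by omega), Nat.div_eq_of_lt (by omega), add_zero]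
  have hmod : ∀ (j : Fin k) (i : ℕ), i ≤ m → (rowStart m j + i) % (m + 1) = i := by
    intro j i hi
    rw [rowStart, mul_comm, Nat.mul_add_mod, Nat.mod_eq_of_lt (by omega)]
  refine Prod.ext ?_ ?_
  · ext j i
    simp only [proj, AddMonoidHom.coe_mk, ZeroHom.coe_mk, Matrix.of_apply]
    have h1 := hdiv j i i.2.le
    have h2 := hmod j i i.2.le
    rw [dif_pos (by rw [h1]; exact j.2), dif_pos (by rw [h2]; exact i.2)]
    congr 1 <;> ext <;> simp [h1, h2]
  · funext j
    simp only [proj, AddMonoidHom.coe_mk, ZeroHom.coe_mk]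
    have h1 := hdiv j m le_rfl
    have h2 := hmod j m le_rfl
    rw [dif_pos (by rw [h1]; exact j.2), dif_neg (by rw [h2]; exact lt_irrefl m)]
    congr 1; ext; simp [h1]

/-- `|𝔽₂^ℓ| = 2^ℓ`. [folklore] -/
theorem card_coinVec (ℓ : ℕ) : Fintype.card (Fin ℓ → ZMod 2) = 2 ^ ℓ := by
  simp [ZMod.card, Fintype.card_fin]

/-- **Equal fibres**: the coin vectors whose hash has a property are `#{h | P h} · 2^ℓ / |H|`.
[folklore] -/
theorem card_filter_proj {m k ℓ : ℕ} (hℓ : k * (m + 1) ≤ ℓ) (P : Hash m k → Prop) :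
    (univ.filter fun v : Fin ℓ → ZMod 2 => P (proj m k ℓ hℓ v)).card * Fintype.card (Hash m k) =
      (univ.filter fun h : Hash m k => P h).card * 2 ^ ℓ := by
  rw [card_eq_sum_card_fiberwise (f := proj m k ℓ hℓ) (t := univ.filter fun h : Hash m k => P h)
    (fun v hv => by simpa using hv), sum_mul]
  have hfib : ∀ h ∈ univ.filter (fun h : Hash m k => P h),
      (filter (fun v => proj m k ℓ hℓ v = h) (univ.filter fun v : Fin ℓ → ZMod 2 => P (proj m k ℓ hℓ v))).card *
        Fintype.card (Hash m k) = 2 ^ ℓ := by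
    intro h hh
    have hP : P h := (mem_filter.1 hh).2
    rw [filter_filter, ← card_coinVec ℓ,
      ← Literature.Computability.AlgebraicComplexity.card_filter_mul_card_eq_card_of_surjective _ (proj_surjective hℓ) h]
    congr 2
    ext v
    simp only [mem_filter, mem_univ, true_and, and_iff_right_iff_imp]
    rintro rfl; exact hP
  rw [sum_congr rfl hfib, sum_const, smul_eq_mul]

/-- `Bool ≃ 𝔽₂`. [folklore] -/
def boolEquivZ : Bool ≃ ZMod 2 where
  toFun := bz
  invFun z := decide (z = 1)
  left_inv b := by cases b <;> decide
  right_inv z := by revert z; decide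

/-- Coin strings of length `ℓ` as coin vectors `𝔽₂^ℓ`. [folklore] -/
def coinEquiv (ℓ : ℕ) : List.Vector Bool ℓ ≃ (Fin ℓ → ZMod 2) :=
  (Equiv.vectorEquivFin Bool ℓ).trans (Equiv.arrowCongr (Equiv.refl _) boolEquivZ)

/-- `coinEquiv` reads bit `n` as an element of `𝔽₂`. [folklore] -/
theorem coinEquiv_apply {ℓ : ℕ} (u : List.Vector Bool ℓ) (n : Fin ℓ) :
    coinEquiv ℓ u n = bz (u.get n) := rfl

/-- The coin hash of a string is the projection of its coin vector. [folklore] -/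
theorem coinHash_eq_proj {m k ℓ : ℕ} (hℓ : k * (m + 1) ≤ ℓ) (u : List.Vector Bool ℓ) :
    coinHash u.toList m k = proj m k ℓ hℓ (coinEquiv ℓ u) := by
  have hbit : ∀ (n : ℕ) (hn : n < ℓ), bz (coinBit u.toList n) = coinEquiv ℓ u ⟨n, hn⟩ := by
    intro n hn
    rw [coinEquiv_apply, get_eq_getD]; rfl
  refine Prod.ext ?_ ?_
  · ext j i; exact hbit _ _
  · funext j; exact hbit _ _

/-- **Equal fibres, for coin strings**: `#{u ∈ {0,1}^ℓ | P (h_k(u))} · |H_k| = #{h | P h} · 2^ℓ`.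
[folklore] -/
theorem card_filter_coinHash {m k ℓ : ℕ} (hℓ : k * (m + 1) ≤ ℓ) (P : Hash m k → Prop) :
    (univ.filter fun u : List.Vector Bool ℓ => P (coinHash u.toList m k)).card *
        Fintype.card (Hash m k) =
      (univ.filter fun h : Hash m k => P h).card * 2 ^ ℓ := by
  rw [← card_filter_proj hℓ P]
  congr 1
  refine card_equiv (coinEquiv ℓ) fun u => ?_
  simp only [mem_filter, mem_univ, true_and, coinHash_eq_proj hℓ]

/-! ### The union bound over the heavy levels -/

/-- `Σ_{k<n} 2^k + 1 = 2^n`. [folklore] -/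
theorem sum_two_pow_succ (n : ℕ) : ∑ k ∈ range n, 2 ^ k + 1 = 2 ^ n := by
  induction n with
  | zero => simp
  | succ n ih => rw [sum_range_succ, pow_succ]; omega

/-- The heavy levels `{k ≤ m | C·2^k ≤ s}` have `C · Σ 2^k ≤ 2s` (a geometric sum up to
`⌊log₂(s/C)⌋`). [folklore] -/
theorem mul_sum_heavy_le (C s m : ℕ) (hC : 0 < C) :
    C * ∑ k ∈ (range (m + 1)).filter (fun k => C * 2 ^ k ≤ s), 2 ^ k ≤ 2 * s := by
  by_cases hsC : s < C
  · have : (range (m + 1)).filter (fun k => C * 2 ^ k ≤ s) = ∅ := by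
      apply filter_eq_empty_iff.2
      intro k _ h
      have : C ≤ C * 2 ^ k := Nat.le_mul_of_pos_right C (by positivity)
      omega
    rw [this, sum_empty, mul_zero]; exact Nat.zero_le _
  push Not at hsC
  set k₁ := Nat.log 2 (s / C)
  have hq : 1 ≤ s / C := (Nat.le_div_iff_mul_le hC).2 (by simpa using hsC)
  have hpow : 2 ^ k₁ ≤ s / C := Nat.pow_log_le_self 2 (by omega)
  have hsub : (range (m + 1)).filter (fun k => C * 2 ^ k ≤ s) ⊆ range (k₁ + 1) := by
    intro k hk
    rw [mem_filter] at hk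
    have h2 : 2 ^ k ≤ s / C := (Nat.le_div_iff_mul_le hC).2 (by rw [mul_comm]; exact hk.2)
    have := Nat.le_log_of_pow_le (by norm_num) h2
    exact mem_range.2 (by omega)
  calc C * ∑ k ∈ (range (m + 1)).filter (fun k => C * 2 ^ k ≤ s), 2 ^ k
      ≤ C * ∑ k ∈ range (k₁ + 1), 2 ^ k := Nat.mul_le_mul_left C (sum_le_sum_of_subset hsub)
    _ ≤ C * (2 * 2 ^ k₁) := by
        apply Nat.mul_le_mul_left
        have := sum_two_pow_succ (k₁ + 1); rw [pow_succ] at this; omega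
    _ = 2 * (C * 2 ^ k₁) := by ring
    _ ≤ 2 * s := by
        apply Nat.mul_le_mul_left
        exact (Nat.mul_le_mul_left C hpow).trans (Nat.mul_div_le s C)

/-- **Few coin strings give a bad hash at some heavy level.** With `C = 2E²kδ`:
`#{u ∈ {0,1}^ℓ | ∃ k ≤ m heavy, h_k(u) ∈ badHash} · kδ ≤ 2^ℓ` (per level the bad fraction is
`≤ E² 2^k/s` by Chebyshev and equal fibres; summed over the heavy levels `≤ 2E²/C = 1/kδ`).
[cite: AaronsonArkhipovToC2013, Thm. 4.1 (p. 175)] -/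
theorem card_badCoins_mul_le {m ℓ E kδ : ℕ} (S : Finset (Fin m → ZMod 2)) (hE : 0 < E)
    (hℓ : m * (m + 1) ≤ ℓ) :
    (univ.filter fun u : List.Vector Bool ℓ => ∃ k ≤ m, 2 * E ^ 2 * kδ * 2 ^ k ≤ S.card ∧
        coinHash u.toList m k ∈ badHash E S).card * kδ ≤ 2 ^ ℓ := by
  rcases Nat.eq_zero_or_pos kδ with rfl | hkδ
  · simp
  set C := 2 * E ^ 2 * kδ with hCdef
  have hC : 0 < C := by positivity
  set s := S.card with hsdef
  -- the bad sets per level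
  set B : ℕ → Finset (List.Vector Bool ℓ) := fun k =>
    univ.filter fun u => coinHash u.toList m k ∈ badHash E S with hB
  set heavy := (range (m + 1)).filter (fun k => C * 2 ^ k ≤ s) with hheavy
  have hsub : (univ.filter fun u : List.Vector Bool ℓ => ∃ k ≤ m, C * 2 ^ k ≤ s ∧
      coinHash u.toList m k ∈ badHash E S) ⊆ heavy.biUnion B := by
    intro u hu
    obtain ⟨k, hk, hh, hb⟩ := (mem_filter.1 hu).2
    exact mem_biUnion.2 ⟨k, mem_filter.2 ⟨mem_range.2 (by omega), hh⟩, mem_filter.2 ⟨mem_univ _, hb⟩⟩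
  -- per level: `#B_k · s ≤ E² 2^k 2^ℓ`
  have hlevel : ∀ k ∈ heavy, (B k).card * s ≤ E ^ 2 * 2 ^ k * 2 ^ ℓ := by
    intro k hk
    have hkm : k ≤ m := by have := mem_range.1 (mem_filter.1 hk).1; omega
    have hkℓ : k * (m + 1) ≤ ℓ := (Nat.mul_le_mul_right _ hkm).trans hℓ
    have hfib := card_filter_coinHash hkℓ (fun h => h ∈ badHash E S)
    have hcheb := card_badHash_mul_le (k := k) E S
    have hHpos : 0 < Fintype.card (Hash m k) := Fintype.card_pos
    have hc : ∀ inst : DecidablePred fun h : Hash m k => h ∈ badHash (k := k) E S,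
        (@Finset.filter (Hash m k) (fun h => h ∈ badHash (k := k) E S) inst univ).card =
          (badHash (k := k) E S).card := by
      intro inst; congr 1; ext h; simp
    rw [hc] at hfib
    -- `#B_k · |H| · s = #bad · 2^ℓ · s ≤ E² 2^k |H| 2^ℓ`
    have hBk : (B k).card * Fintype.card (Hash m k) = (badHash (k := k) E S).card * 2 ^ ℓ := by
      simp only [hB]
      convert hfib using 2
      congr 1; ext u; simp only [mem_filter]
    have : (B k).card * s * Fintype.card (Hash m k) ≤ E ^ 2 * 2 ^ k * 2 ^ ℓ * Fintype.card (Hash m k) := by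
      calc (B k).card * s * Fintype.card (Hash m k)
          = ((B k).card * Fintype.card (Hash m k)) * s := by ring
        _ = (badHash (k := k) E S).card * 2 ^ ℓ * s := by rw [hBk]
        _ = ((badHash (k := k) E S).card * s) * 2 ^ ℓ := by ring
        _ ≤ (E ^ 2 * 2 ^ k * Fintype.card (Hash m k)) * 2 ^ ℓ := Nat.mul_le_mul_right _ hcheb
        _ = E ^ 2 * 2 ^ k * 2 ^ ℓ * Fintype.card (Hash m k) := by ring
    exact le_of_mul_le_mul_right this hHpos
  -- sum over the heavy levels
  have hsum : (heavy.biUnion B).card * s ≤ E ^ 2 * 2 ^ ℓ * ∑ k ∈ heavy, 2 ^ k := by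
    calc (heavy.biUnion B).card * s ≤ (∑ k ∈ heavy, (B k).card) * s :=
          Nat.mul_le_mul_right _ card_biUnion_le
      _ = ∑ k ∈ heavy, (B k).card * s := sum_mul _ _ _
      _ ≤ ∑ k ∈ heavy, E ^ 2 * 2 ^ k * 2 ^ ℓ := sum_le_sum hlevel
      _ = E ^ 2 * 2 ^ ℓ * ∑ k ∈ heavy, 2 ^ k := by rw [mul_sum]; exact sum_congr rfl fun k _ => by ring
  have hgeom := mul_sum_heavy_le C s m hC
  rcases Nat.eq_zero_or_pos s with hs0 | hspos
  · -- no heavy level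
    have : (univ.filter fun u : List.Vector Bool ℓ => ∃ k ≤ m, C * 2 ^ k ≤ s ∧
        coinHash u.toList m k ∈ badHash E S) = ∅ := by
      apply filter_eq_empty_iff.2
      rintro u - ⟨k, -, hh, -⟩
      have : 0 < C * 2 ^ k := by positivity
      omega
    rw [this]; simp
  · -- `card · s · C ≤ E² 2^ℓ · 2 s`, cancel `s`, unfold `C`
    have h1 : (univ.filter fun u : List.Vector Bool ℓ => ∃ k ≤ m, C * 2 ^ k ≤ s ∧
        coinHash u.toList m k ∈ badHash E S).card * s * C ≤ E ^ 2 * 2 ^ ℓ * (2 * s) := by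
      calc _ ≤ (heavy.biUnion B).card * s * C :=
            Nat.mul_le_mul_right _ (Nat.mul_le_mul_right _ (card_le_card hsub))
        _ ≤ (E ^ 2 * 2 ^ ℓ * ∑ k ∈ heavy, 2 ^ k) * C := Nat.mul_le_mul_right _ hsum
        _ = E ^ 2 * 2 ^ ℓ * (C * ∑ k ∈ heavy, 2 ^ k) := by ring
        _ ≤ E ^ 2 * 2 ^ ℓ * (2 * s) := Nat.mul_le_mul_left _ hgeom
    have h2 : (univ.filter fun u : List.Vector Bool ℓ => ∃ k ≤ m, C * 2 ^ k ≤ s ∧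
        coinHash u.toList m k ∈ badHash E S).card * C ≤ E ^ 2 * 2 ^ ℓ * 2 := by
      have h1' : (univ.filter fun u : List.Vector Bool ℓ => ∃ k ≤ m, C * 2 ^ k ≤ s ∧
          coinHash u.toList m k ∈ badHash E S).card * C * s ≤ E ^ 2 * 2 ^ ℓ * 2 * s := by
        calc _ = _ * s * C := by ring
          _ ≤ E ^ 2 * 2 ^ ℓ * (2 * s) := h1
          _ = E ^ 2 * 2 ^ ℓ * 2 * s := by ring
      exact le_of_mul_le_mul_right h1' hspos
    have hE2 : 0 < 2 * E ^ 2 := by positivity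
    have h3 : (univ.filter fun u : List.Vector Bool ℓ => ∃ k ≤ m, C * 2 ^ k ≤ s ∧
        coinHash u.toList m k ∈ badHash E S).card * kδ * (2 * E ^ 2) ≤ 2 ^ ℓ * (2 * E ^ 2) := by
      calc _ = _ * C := by rw [hCdef]; ring
        _ ≤ E ^ 2 * 2 ^ ℓ * 2 := h2
        _ = 2 ^ ℓ * (2 * E ^ 2) := by ring
    exact le_of_mul_le_mul_right h3 hE2

/-! ### Assembly for a relation `R`: counting witnesses -/

/-- The witness set `{y ∈ {0,1}^m | ⟨x, y⟩ ∈ R}` as a subset of `𝔽₂^m`. [folklore] -/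
noncomputable def witnessSet (R : Language Bool) (m : ℕ) (x : List Bool) : Finset (Fin m → ZMod 2) :=
  (univ.filter fun y : List.Vector Bool m => boolPair x y.toList ∈ R).map ⟨toZ, toZ_injective⟩

/-- `|witnessSet R m x| = countWitnesses R m x`. [folklore] -/
theorem card_witnessSet (R : Language Bool) (m : ℕ) (x : List Bool) :
    (witnessSet R m x).card = countWitnesses R m x := by
  rw [witnessSet, card_map, countWitnesses]

/-- `countWitnesses R m x ≤ 2^m`. [folklore] -/
theorem countWitnesses_le_two_pow (R : Language Bool) (m : ℕ) (x : List Bool) :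
    countWitnesses R m x ≤ 2 ^ m := by
  rw [← card_witnessSet]
  exact (card_le_univ _).trans (by rw [card_coinVec])

/-- **The level counts** `Y_k(u) = #{y ∈ {0,1}^m | ⟨x, y⟩ ∈ R ∧ y hashes to 0 at level k}` — the
quantities the `NP^O` oracle is asked about ("`Y_k(u) ≥ c`?"). [cite: AaronsonArkhipovToC2013, Thm. 4.1 (p. 175)] -/
noncomputable def levelCount (R : Language Bool) (m : ℕ) (x u : List Bool) (k : ℕ) : ℕ :=
  (univ.filter fun y : List.Vector Bool m => boolPair x y.toList ∈ R ∧ HashesToZero u m k y.toList).card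

/-- `levelCount` is the zero-count of the witness set under the coin hash. [folklore] -/
theorem levelCount_eq_zeroCount (R : Language Bool) (m : ℕ) (x u : List Bool) (k : ℕ) :
    levelCount R m x u k = zeroCount (witnessSet R m x) (coinHash u m k) := by
  rw [zeroCount, witnessSet, filter_map, card_map, levelCount]
  congr 1
  ext y
  simp only [mem_filter, mem_univ, true_and, Function.Embedding.coeFn_mk, Function.comp_apply,
    hash_coinHash_eq_zero_iff]

/-- At level `0` everything hashes to zero: `Y_0 = countWitnesses R m x`. [folklore] -/
theorem levelCount_zero (R : Language Bool) (m : ℕ) (x u : List Bool) :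
    levelCount R m x u 0 = countWitnesses R m x := by
  rw [levelCount_eq_zeroCount, zeroCount_zero, card_witnessSet]

/-- **Stockmeyer's estimator is probably approximately correct** (counting form). For
`kη, kδ ≥ 1`, `T ≥ 24 kη² kδ` and `ℓ ≥ m(m+1)` coins: the coin strings `u ∈ {0,1}^ℓ` on which the
estimate `N(u)` computed from the capped level counts fails `#/(1 + 1/kη) ≤ N ≤ (1 + 1/kη)·#`,
`# = countWitnesses R m x`, number at most `2^ℓ/kδ`. [cite: AaronsonArkhipovToC2013, Thm. 4.1 (p. 175)] -/
theorem card_not_isApproxCount_mul_le (R : Language Bool) (x : List Bool) {m kη kδ T ℓ : ℕ}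
    (hkη : 0 < kη) (hT : 24 * kη ^ 2 * kδ ≤ T) (hℓ : m * (m + 1) ≤ ℓ) :
    (univ.filter fun u : List.Vector Bool ℓ => ¬ IsApproxCount kη (countWitnesses R m x)
        (estimate m T (levelCount R m x u.toList))).card * kδ ≤ 2 ^ ℓ := by
  rcases Nat.eq_zero_or_pos kδ with rfl | hkδ
  · simp
  have hE : 0 < 2 * kη := by omega
  refine le_trans (Nat.mul_le_mul_right _ (card_le_card ?_))
    (card_badCoins_mul_le (E := 2 * kη) (kδ := kδ) (witnessSet R m x) hE hℓ)
  intro u hu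
  rw [mem_filter] at hu ⊢
  refine ⟨mem_univ _, ?_⟩
  by_contra hgood
  push Not at hgood
  apply hu.2
  have hC : 0 < 2 * (2 * kη) ^ 2 * kδ := by positivity
  refine isApproxCount_estimate hkη hC (T := T) ?_ (levelCount_zero R m x u.toList)
    (countWitnesses_le_two_pow R m x) ?_
  · calc 3 * (2 * (2 * kη) ^ 2 * kδ) = 24 * kη ^ 2 * kδ := by ring
      _ ≤ T := hT
  · intro k hk hheavy
    have hnot := hgood k hk (by rw [card_witnessSet]; exact hheavy)
    rw [badHash, mem_filter, not_and] at hnot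
    have hlt := not_le.1 (hnot (mem_univ _))
    rw [dev, card_witnessSet, ← levelCount_eq_zeroCount] at hlt
    push_cast at hlt ⊢
    exact hlt

/-- A counting bound `#E · kδ ≤ 2^ℓ` (for whichever decidability instance) bounds the uniform
probability: `Pr_u[u ∈ E] ≤ 1/kδ`. [folklore] -/
theorem uniformProb_le_of_card_mul_le {ℓ kδ : ℕ} {E : Set (List Bool)} (hkδ : 0 < kδ)
    (h : ∀ inst : DecidablePred fun r : List.Vector Bool ℓ => r.toList ∈ E,
      (@Finset.filter (List.Vector Bool ℓ) (fun r => r.toList ∈ E) inst univ).card * kδ ≤ 2 ^ ℓ) :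
    uniformProb ℓ E ≤ 1 / (kδ : ℝ) := by
  rw [uniformProb, div_le_div_iff₀ (by positivity) (by exact_mod_cast hkδ), one_mul]
  exact_mod_cast h _

/-- **Stockmeyer's estimator is probably approximately correct**: under the hypotheses of
`card_not_isApproxCount_mul_le`, `Pr_u[¬(#/(1 + 1/kη) ≤ N(u) ≤ (1 + 1/kη)·#)] ≤ 1/kδ` for a
uniformly random coin string `u ∈ {0,1}^ℓ` (`uniformProb`). This is the probabilistic content of
AA13 Thm. 4.1 / Stockmeyer's theorem; the machines asking the `NP^O` oracle the threshold
questions "`Y_k(u) ≥ c`?" and evaluating `estimate` are the remaining (programming) part of a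
discharge of `stockmeyerApproxCounting`. [cite: AaronsonArkhipovToC2013, Thm. 4.1 (p. 175)] -/
theorem uniformProb_not_isApproxCount_le (R : Language Bool) (x : List Bool) {m kη kδ T ℓ : ℕ}
    (hkη : 0 < kη) (hkδ : 0 < kδ) (hT : 24 * kη ^ 2 * kδ ≤ T) (hℓ : m * (m + 1) ≤ ℓ) :
    uniformProb ℓ {u | ¬ IsApproxCount kη (countWitnesses R m x)
        (estimate m T (levelCount R m x u))} ≤ 1 / (kδ : ℝ) := by
  refine uniformProb_le_of_card_mul_le hkδ fun inst => ?_
  convert card_not_isApproxCount_mul_le R x hkη hT hℓ (kδ := kδ) using 3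
  ext r; simp only [mem_filter, Set.mem_setOf_eq]

end Stockmeyer

end Literature.Computability.Complexity
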